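import Literature.AlgebraicGeometry.Resolution.Temkin2013CurveSmoothingProofs
import HarnessLib

/-!
# Thm. 3.3.1 (`n = 1`) of Temkin 2013 is equivalent to its smooth-fibre case (proofs file)

Topic: `Literature/AlgebraicGeometry/Resolution`. Companion proofs file of
`InseparableLocalUniformizationCurves.lean`, which vendors M. Temkin, *Inseparable local
uniformization*, J. Algebra 373 (2013) 65–119 = arXiv:0804.1554v3, Thm. 3.3.1 in the case
`n = 1` (p. 44 of v3; p. 26 of the 41-pp. arXiv version held in the literature store) as the
named fact `Temkin2013RelativeCurve`.

The printed proof of Thm. 3.3.1 has three steps and a conclusion (v3 pp. 44–45; held copy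
pp. 27–28). Step 1 ("Reduction to the case when `C̄_η` is `k`-smooth": a finite purely
inseparable extension `F/k` of the ground field and normalization make the generic fibres
`k`-smooth, and the theorem for `F`, `Nr_{FK}(C)`, `FKᵢ` gives it for `k`, `C`, `Kᵢ` via
`A' = A_F ∩ K ⊇ A_F^{pⁿ}`) is PROVED in the tree:
`Temkin2013RelativeCurve.of_smoothGenericFibre` (`InseparableLocalUniformizationCurvesStepOne.lean`)
assembles the fact from the curve-smoothing lemma `Temkin2013CurveSmoothing` (Görtz–Wedhorn II,
Lemma 26.43 (1)) and the smooth-fibre case `Temkin2013RelativeCurveSmoothFibre` (Steps 2–3 and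
the conclusion: the Berkovich-analytic inseparable uniformization of terminal points Thm. 3.2.6,
Krasner's lemma, algebraization of a Weierstrass domain, Thm. 2.8.2 (ii)). The curve-smoothing
lemma is now a theorem of the tree (`Temkin2013CurveSmoothing_holds`,
`Temkin2013CurveSmoothingProofs.lean`), so:

* `Temkin2013RelativeCurve.of_smoothFibre` — PROVED: Thm. 3.3.1 (`n = 1`) follows from the single
  named fact `Temkin2013RelativeCurveSmoothFibre`;
* `temkin2013RelativeCurve_iff_smoothFibre` — PROVED: the two named facts are EQUIVALENT (the
  converse, `Temkin2013RelativeCurve.smoothFibre`, is the trivial specialization). The trust base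
  of `Temkin2013RelativeCurve` is therefore exactly `{Temkin2013RelativeCurveSmoothFibre}`, whose
  printed proof is non-archimedean analytic geometry (affinoid generic fibres of `π`-adic
  completions, Berkovich curves, the stable modification theorem of [Tem3]) with no counterpart
  in Mathlib; the discharge `Temkin2013RelativeCurve_holds` is to be appended here as
  `Temkin2013RelativeCurve.of_smoothFibre Temkin2013RelativeCurveSmoothFibre_holds` once that
  fact is a theorem.

Nothing new is claimed; no statement is introduced or changed.

## Source

* M. Temkin, *Inseparable local uniformization*, arXiv:0804.1554v3 = J. Algebra 373 (2013)
  65–119: Thm. 3.3.1 and its proof, Step 1 (pp. 44–45); Thm. 3.2.6 (p. 43); Thm. 2.8.2 (p. 29).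
  Held copy (41 pp.): Thm. 3.3.1 p. 26, proof pp. 27–28, Thm. 2.7.2 p. 18.
-/

namespace Literature.AlgebraicGeometry.Resolution

universe u

/-- **Thm. 3.3.1 (`n = 1`) from its `k`-smooth-fibre case alone.** With the curve-smoothing
lemma proved (`Temkin2013CurveSmoothing_holds`), Step 1 of the printed proof
(`Temkin2013RelativeCurve.of_smoothGenericFibre`: "So, we can extend the ground valued field `k`
to `F`, achieving that the generic fibers are `k`-smooth") reduces the named fact
`Temkin2013RelativeCurve` to the single named fact `Temkin2013RelativeCurveSmoothFibre`
(Steps 2–3 of the proof). [cite: Temkin2013, Thm. 3.3.1, proof, Step 1 (arXiv:0804.1554v3 pp. 44–45)] -/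
theorem Temkin2013RelativeCurve.of_smoothFibre (hsf : Temkin2013RelativeCurveSmoothFibre.{u}) :
    Temkin2013RelativeCurve.{u} :=
  Temkin2013RelativeCurve.of_smoothGenericFibre Temkin2013CurveSmoothing_holds hsf

/-- **Thm. 3.3.1 (`n = 1`) and its smooth-fibre case are equivalent named facts**: the trust
base of `Temkin2013RelativeCurve` is exactly `{Temkin2013RelativeCurveSmoothFibre}`.
[cite: Temkin2013, Thm. 3.3.1] -/
theorem temkin2013RelativeCurve_iff_smoothFibre :
    Temkin2013RelativeCurve.{u} ↔ Temkin2013RelativeCurveSmoothFibre.{u} :=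
  ⟨Temkin2013RelativeCurve.smoothFibre, Temkin2013RelativeCurve.of_smoothFibre⟩

end Literature.AlgebraicGeometry.Resolution
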